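import Summits.BirchSwinnertonDyer.Rank1Residual.X10.SecondDescentOneLineBound
import HarnessLib

/-!
# ONE second-descent line + `#Ш[p] ≤ p²` ⇒ `BSD(E,p)` WITHOUT the torsion hypothesis `p ∤ #E(ℚ)_tors` — the torsion-agnostic door for Ш-cells whose curve carries a rational point of order `3` (reducible `E[3]`, the (3, X3) programme) (cell `b2b-bsdres`, unit `b2b-bsdres-x10`, gen 52)

HONEST FRAMING (run/shared/lean/b2b/bsd-rank1-residual/, verbatim in every file): the goal of the
cell is to DELETE the COMBINATION-SHAPED residual classes of the Birch–Swinnerton-Dyer formula for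
ALL analytic-rank `≤ 1` elliptic curves over `ℚ` — "full BSD formula for every rank `≤ 1` curve in
class `C`" assembled STRICTLY from published theorems — so that the rank-`≤ 1` remainder becomes
exactly the CONSTRUCTION-SHAPED classes, which are TYPED (missing-input `Prop`s), NOT attempted.
This is not "finishing BSD". Theorems only (no definition, no new named fact); NOTHING IS BOOKED
here; no class label changes (X3 stays CONSTRUCTION-SHAPED at class level; X10b stays
CONSTRUCTION-SHAPED / NEEDS X_A3). Per pair.

**What this file is.** The bound-variant ONE-LINE door `X10/SecondDescentOneLineBound.lean`
(p688153, §4 `bsdp_three_of_oneNonDivisible_of_card_le`) displays `htors : 3 ∤ #E(ℚ)_tors` because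
it routes through the `p`-descent COUNT `#Sel^(p)(E/ℚ) = p²` (p213922's bijection `Sel^(p) ≅ Ш[p]`
at rank `0` needs `pE(ℚ) = E(ℚ)`). That detour is unnecessary: Miller's `BSD(E,p)` speaks of
`#Ш(E/ℚ)(p)` only, and the two algebraic steps of the bound door already live on `Ш` —
`#Ш[p] = p²` (`natCard_torsionBy_eq_sq_of_le_of_ne_zero`: squareness under the alternating
non-degenerate Cassels–Tate pairing + the bound + one non-zero class) and `Ш[p²] = Ш[p]`
(`sq_nsmul_stable_of_oneNonDivisible`: the Gram partner of the non-divisible class) — so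
`Ш(p) = Ш[p]` (`primaryComponent_eq_torsionBy_of_sq`) has order `p²` and `ord_p #Ш_an = 2` is the
formula at `p`, WHATEVER `E(ℚ)_tors` is. This matters for the (3, X3) classes: 73 of the 198 have a
rational point of order `3` on Cremona's curve 1, and in 35 of them every torsion-FREE isogenous
member has `ord₃ #Ш_an = 4` (the `(9,81)` pattern), so the torsion curve is the only member a
level-`9` certificate can address; the isogeny-descent engines (`isodesc3` ‖ `isodesc3_e2`) already
return `a = dim Ш(E)[φ]`, `b = dim Ш(E′)[φ̂]` with the torsion part of `Sel^φ` removed, and the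
second-descent engines run on the isogeny cubics of a curve with rational `3`-torsion exactly as on
any other (the torsion line of `Sel^φ` is the one cubic with a rational point — CONSISTENT, never
cited). Contents:
* §1 (any number field, `Ш` finite, bsd.S18 displayed): `#Ш(E/K)(p) = p²` from `#Ш[p] ≤ p²` + ONE
  non-divisible non-zero `p`-torsion class — `card_primaryComponent_sha_eq_sq_of_oneNonDivisible_of_card_le`;
* §2 (over `ℚ`, GZK): `bsdp_of_card_le_of_oneNonDivisible` and `padicValNat_shaOrder_eq_two_of_card_le_of_oneNonDivisible`
  — the §3 theorems of the bound door with the binder `htors` DELETED (not replaced by anything; the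
  bound door's `bsdp_of_oneNonDivisible_of_card_le` is the special case that ignores its `htors`);
* §3 the record shape at `p = 3`: `bsdp_three_of_card_le_of_oneNonDivisible (hCT) (hGZK) (W) (hr) (hub) (h1) (hq) (hv)`.
Displayed binders of a record: `hCT` (bsd.S18), `hGZK`, `hr : r_an = 0`, `hub : #Ш[3] ≤ 9` (two-engine
exact isogeny descents, `a + b ≤ 2`), `h1` (two-engine EMPTY second `3`-descent on a minimised isogeny
cubic), `hq`/`hv : ord₃ #Ш_an = 2` — and nothing about torsion. No pairing VALUE, no Kato / Skinner–Urban /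
main conjecture, no image or reduction hypothesis.

References: Cassels 1962 (IV) [Cassels1962ArithmeticIV]; Cassels 1998 §1 [Cassels1998]; Silverman AEC
Thm. X.4.14 [SilvermanAEC2009]; B. Creutz, Math. Comp. 83 (2014) Thm. 7.2, Alg. 7.3 [Creutz2014];
R. L. Miller 2011 Def. 1.1 [Miller2011LMS]; companions `X10/SecondDescentOneLine` (p685094),
`X10/SecondDescentOneLineBound` (p688153, p692621), `X10/CasselsTatePairingCertificate` (p213922);
cell files X10-AUDIT.md §57–§58, `g51/C9-NEXT.md` §3.
-/

set_option autoImplicit false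

noncomputable section

open scoped Classical AddSubgroup

open WeierstrassCurve Literature.NumberTheory.EllipticCurves
  Literature.NumberTheory.EllipticCurves.Rank1Residual
  Literature.NumberTheory.EllipticCurves.Rank1Residual.Typed
  Literature.NumberTheory.EllipticCurves.Rank1Residual.X11RankOneCertificates
  Literature.GroupTheory.FiniteAbelian
  Summit.BirchSwinnertonDyer.BirchSwinnertonDyer.Rank1Residual.IntModel
  Summit.BirchSwinnertonDyer.BirchSwinnertonDyer.Rank1Residual.X11RankOne
  Summit.BirchSwinnertonDyer.Rank1Residual.X11b

namespace Summit.BirchSwinnertonDyer.Rank1Residual.X10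

/-! ### §1 Any number field, `Ш` finite: `#Ш(E/K)(p) = p²` from bsd.S18 + `#Ш[p] ≤ p²` + ONE line — no torsion hypothesis -/

section General

variable {K : Type*} [Field K] [NumberField K] (W : WeierstrassCurve K) [W.IsElliptic]

/-- **`#Ш(E/K)[p] = p²` from bsd.S18, the bound `#Ш[p] ≤ p²` and ONE non-zero `p`-torsion class**
(`Ш` finite makes the displayed Cassels–Tate pairing non-degenerate; then Cassels' squareness at
level `p`, `natCard_torsionBy_eq_sq_of_le_of_ne_zero`). No rank, no torsion hypothesis.
[cite: Cassels1962ArithmeticIV] [cite: SilvermanAEC2009, Thm. X.4.14] -/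
theorem natCard_sha_torsionBy_eq_sq_of_ne_zero_of_card_le
    (hCT : exists_casselsTate_pairing (K := K)) [Finite W.sha] (p : ℕ) [Fact p.Prime]
    (hub : Nat.card (AddSubgroup.torsionBy W.sha p) ≤ p ^ 2)
    {x₀ : W.sha} (hx₀ : p • x₀ = 0) (hx₀ne : x₀ ≠ 0) :
    Nat.card (AddSubgroup.torsionBy W.sha p) = p ^ 2 := by
  obtain ⟨B, halt, hker⟩ := hCT W
  have hnd : ∀ x : W.sha, (∀ y, B x y = 0) → x = 0 := fun x hx => by
    have hmem : x ∈ AddSubgroup.divisibleElements W.sha := (hker x).mp hx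
    rwa [divisibleElements_eq_bot_of_finite, AddSubgroup.mem_bot] at hmem
  exact natCard_torsionBy_eq_sq_of_le_of_ne_zero B halt hnd p hub hx₀ hx₀ne

/-- **`#Ш(E/K)(p) = p²` EXACTLY from bsd.S18, `#Ш[p] ≤ p²` and ONE non-divisible non-zero
`p`-torsion class of `Ш`** (`Ш` finite): `Ш[p²] = Ш[p]` (`shaNoPSqTorsion_of_oneNonDivisible_of_card_le`)
makes the `p`-primary component equal to `Ш[p]` (`primaryComponent_eq_torsionBy_of_sq`), whose order is
`p²` by the previous theorem. No rank, no torsion hypothesis. [cite: Cassels1962ArithmeticIV]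
[cite: Cassels1998, §1] [cite: Creutz2014, Thm. 7.2] -/
theorem card_primaryComponent_sha_eq_sq_of_oneNonDivisible_of_card_le
    (hCT : exists_casselsTate_pairing (K := K)) [Finite W.sha] (p : ℕ) [Fact p.Prime]
    (hub : Nat.card (AddSubgroup.torsionBy W.sha p) ≤ p ^ 2)
    (h1 : ∃ x : W.sha, p • x = 0 ∧ x ≠ 0 ∧ ∀ z : W.sha, p • z ≠ x) :
    Nat.card (AddCommGroup.primaryComponent W.sha p) = p ^ 2 := by
  obtain ⟨x₀, hx₀, hx₀ne, hx₀nd⟩ := h1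
  rw [card_primaryComponent_eq_card_torsionBy_of_sq
    (shaNoPSqTorsion_of_oneNonDivisible_of_card_le W hCT p hub ⟨x₀, hx₀, hx₀ne, hx₀nd⟩)]
  exact natCard_sha_torsionBy_eq_sq_of_ne_zero_of_card_le W hCT p hub hx₀ hx₀ne

end General

/-! ### §2 Over `ℚ`: Miller's `BSD(E,p)` from GZK + bsd.S18 + `#Ш[p] ≤ p²` + ONE line — the binder `p ∤ #E(ℚ)_tors` deleted -/

section OverQ

variable (W : WeierstrassCurve ℚ) [W.IsElliptic] (p : ℕ) [Fact p.Prime]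

/-- **`BSD(E,p)` at a rank-`0` pair from the Cassels–Tate pairing fact, the bound `#Ш[p] ≤ p²`, ONE
non-divisible non-zero `p`-torsion class of `Ш`, and `ord_p #Ш_an = 2` — for ANY `E(ℚ)_tors`.**
Gross–Zagier–Kolyvagin (`hGZK`) gives rank `0 = r_an` and `Ш` finite; §1 gives `#Ш(E/ℚ)(p) = p²`;
Miller's clause (iv) is then `ord_p q = 2`. Class-free, image-free, torsion-free; per curve.
[cite: Miller2011LMS, §1 and Def. 1.1] [cite: Creutz2014, Thm. 7.2] [cite: Cassels1962ArithmeticIV]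
[cite: SilvermanAEC2009, Thm. X.4.14] -/
theorem bsdp_of_card_le_of_oneNonDivisible
    (hCT : exists_casselsTate_pairing (K := ℚ)) (hGZK : rank_eq_analyticRank_of_analyticRank_le_one)
    (hr : W.analyticRank = 0)
    (hub : Nat.card (AddSubgroup.torsionBy W.sha p) ≤ p ^ 2)
    (h1 : ∃ x : W.sha, p • x = 0 ∧ x ≠ 0 ∧ ∀ z : W.sha, p • z ≠ x)
    {q : ℚ} (hq : shaAn W = (q : ℂ)) (hv : padicValRat p q = 2) : BSDp W p := by
  have hr1 : W.analyticRank ≤ 1 := by rw [hr]; norm_num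
  obtain ⟨hrank', hfin⟩ := hGZK W hr1
  haveI : Finite W.sha := hfin
  refine ⟨hrank', Finite.of_injective _ Subtype.val_injective, q, hq, ?_⟩
  rw [card_primaryComponent_sha_eq_sq_of_oneNonDivisible_of_card_le W hCT p hub h1,
    padicValNat.prime_pow]
  exact_mod_cast hv

/-- **The exact `p`-part on such a pair, no analytic value and no torsion hypothesis:
`ord_p #Ш(E/ℚ) = 2`.** [cite: Cassels1962ArithmeticIV] [cite: Creutz2014, Thm. 7.2] -/
theorem padicValNat_shaOrder_eq_two_of_card_le_of_oneNonDivisible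
    (hCT : exists_casselsTate_pairing (K := ℚ)) (hGZK : rank_eq_analyticRank_of_analyticRank_le_one)
    (hr : W.analyticRank = 0)
    (hub : Nat.card (AddSubgroup.torsionBy W.sha p) ≤ p ^ 2)
    (h1 : ∃ x : W.sha, p • x = 0 ∧ x ≠ 0 ∧ ∀ z : W.sha, p • z ≠ x) :
    padicValNat p W.shaOrder = 2 := by
  have hr1 : W.analyticRank ≤ 1 := by rw [hr]; norm_num
  haveI : Finite W.sha := (hGZK W hr1).2
  rw [WeierstrassCurve.shaOrder, ← padicValNat_card_addPrimaryComponent (A := W.sha) p,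
    card_primaryComponent_sha_eq_sq_of_oneNonDivisible_of_card_le W hCT p hub h1,
    padicValNat.prime_pow]

end OverQ

/-! ### §3 The record shape at `p = 3` (reducible `E[3]`, ANY rational torsion; the record substitutes the literal model and decides `Δ ≠ 0`) -/

/-- **The C9-RED record shape, torsion-agnostic** (`p = 3`): bsd.S18 (`hCT`), GZK, analytic rank
`0`, `#Ш[3] ≤ 9` (two-engine exact `3`-isogeny descents: `a + b ≤ 2`), ONE non-divisible non-zero
class of `Ш[3]` (two-engine EMPTY second `3`-descent on a minimised isogeny cubic `D_min`, Creutz 2014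
§7: `Sel^(3)(D_min/ℚ) = ∅ ⇒ [D_α] ≠ 0` and `[D_α] ∉ 3·Ш`), `ord₃ #Ш_an = 2` ⇒ Miller's `BSD(E,3)`.
A rational point of order `3` on `E` is ALLOWED (it changes `#Sel^(3)`, which this door never
mentions, and enters `#Ш_an` through Cremona's torsion column as always). Per pair; books nothing.
[cite: Creutz2014, Thm. 7.2 and Alg. 7.3] [cite: Cassels1962ArithmeticIV] [cite: Miller2011LMS, Def. 1.1]
[cite: SilvermanAEC2009, Thm. X.4.14] -/
theorem bsdp_three_of_card_le_of_oneNonDivisible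
    (hCT : exists_casselsTate_pairing (K := ℚ)) (hGZK : rank_eq_analyticRank_of_analyticRank_le_one)
    (W : WeierstrassCurve ℚ) [W.IsElliptic]
    (hr : W.analyticRank = 0)
    (hub : Nat.card (AddSubgroup.torsionBy W.sha 3) ≤ 9)
    (h1 : ∃ x : W.sha, 3 • x = 0 ∧ x ≠ 0 ∧ ∀ z : W.sha, 3 • z ≠ x)
    {q : ℚ} (hq : shaAn W = (q : ℂ)) (hv : padicValRat 3 q = 2) : BSDp W 3 := by
  haveI : Fact (Nat.Prime 3) := ⟨by norm_num⟩
  exact bsdp_of_card_le_of_oneNonDivisible W 3 hCT hGZK hr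
    (by rw [show (3 : ℕ) ^ 2 = 9 by norm_num]; exact hub) h1 hq hv

/-- **The exact `3`-part under the same data: `ord₃ #Ш(E/ℚ) = 2`** (`#Ш(E/ℚ)[3^∞] = 9`), any torsion.
[cite: Cassels1962ArithmeticIV] [cite: Creutz2014, Thm. 7.2] -/
theorem padicValNat_shaOrder_three_eq_two_of_card_le_of_oneNonDivisible
    (hCT : exists_casselsTate_pairing (K := ℚ)) (hGZK : rank_eq_analyticRank_of_analyticRank_le_one)
    (W : WeierstrassCurve ℚ) [W.IsElliptic]
    (hr : W.analyticRank = 0)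
    (hub : Nat.card (AddSubgroup.torsionBy W.sha 3) ≤ 9)
    (h1 : ∃ x : W.sha, 3 • x = 0 ∧ x ≠ 0 ∧ ∀ z : W.sha, 3 • z ≠ x) :
    padicValNat 3 W.shaOrder = 2 := by
  haveI : Fact (Nat.Prime 3) := ⟨by norm_num⟩
  exact padicValNat_shaOrder_eq_two_of_card_le_of_oneNonDivisible W 3 hCT hGZK hr
    (by rw [show (3 : ℕ) ^ 2 = 9 by norm_num]; exact hub) h1

end Summit.BirchSwinnertonDyer.Rank1Residual.X10

end
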